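import Summits.HodgeConjecture.HodgeConjecture.Theorems.F0P3cStCharTSHCDescentSemisimpleSliceK   -- ★ C₁ (F0P3a-p05): `cayley` frame (`Literature.Analysis.Calculus.CayleyTransform`), `isUnit_cayley(_iff)`
import Literature.LinearAlgebra.Matrix.MinimalNilpotentSliceFinThree                               -- ★ (D) (F0P3-p02): `single_two_zero_bracket_eq`
import HarnessLib

/-!
# F0 · P3c · line LH6 «StCharTS» — ROAD «HC-D» brick D5(iii), FILE C₀ «SLODOWY SLICE — SMALL ALGEBRA FOR THE DESCENDED CHART»

Cell `pub/hodgecm-mathlib`, crux H413 = `stmt-HodgeConjecture-24833` (lane `--supports`, helper); seat A-p12 (g29); brick D5(iii) of the ROAD «HC-D» (holder F0P2-p01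
(g23)).  THEOREMS ONLY; sorry-free; no definition ∕ instance ∕ notation ∕ named fact; axioms TRIO.  Three small identities consumed by FILE C `…HCDSlodowySliceChart`:
a SECTION of `ad E₂₀` on its entry shape (so that the transversal part `Q ⊆ range (ad_K E₂₀)`), the unfolding of `ad_K`, and `trace (c(Y)(N + Z)c(Y)⁻¹ − N) = 0`
(total version, junk cases included).  HONEST LABEL: count-neutral; HC_CM is proved only modulo the 7 printed citations (2 remaining: hLiu418 =
`stmt-HodgeConjecture-24832`, h413 = `stmt-HodgeConjecture-24833`) until rung 0 closes.

## References
* [Slodowy1980] P. Slodowy, *Simple Singularities and Simple Algebraic Groups*, LNM 815 (1980), §7.4.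
* [HarishChandra1970] Harish-Chandra (notes by G. van Dijk), *Harmonic analysis on reductive p-adic groups*, LNM 162 (1970), Part V §4 Lemma 22.
-/

set_option autoImplicit false
-- the mandated namespace has the single-problem summit's repeated segment (`HodgeConjecture.HodgeConjecture`)
set_option linter.dupNamespace false

noncomputable section

open Literature.LinearAlgebra.Matrix Literature.Analysis.Calculus

namespace Summit.HodgeConjecture.HodgeConjecture.Cruxes.H413.F0P3cStCharTSHCDSlodowySliceChartAlgebra

/-! ## `Q ⊆ range (ad_K N⁻)`, the unfolding of `ad_K`, `trace (Ψ − N) = 0` -/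

section Algebra

variable {K : Type*} [Field K]

/-- A SECTION of `ad E₂₀` on its entry shape: `Y` with `Y 0 1 = Y 0 2 = Y 1 1 = Y 1 2 = 0`, `Y 0 0 + Y 2 2 = 0` is `E₂₀ A − A E₂₀` for the explicit
`A = !![Y 2 0, Y 2 1, Y 2 2; 0, 0, −Y 1 0; 0, 0, 0]` (★ (D) `single_two_zero_bracket_eq`). [cite: Slodowy1980, §7.4] -/
theorem exists_bracket_single_two_zero_eq_of_shape {Y : Matrix (Fin 3) (Fin 3) K}
    (h : Y 0 1 = 0 ∧ Y 0 2 = 0 ∧ Y 1 1 = 0 ∧ Y 1 2 = 0 ∧ Y 0 0 + Y 2 2 = 0) :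
    ∃ A : Matrix (Fin 3) (Fin 3) K, Matrix.single (2 : Fin 3) (0 : Fin 3) (1 : K) * A - A * Matrix.single (2 : Fin 3) (0 : Fin 3) 1 = Y := by
  obtain ⟨h01, h02, h11, h12, htr⟩ := h
  refine ⟨!![Y 2 0, Y 2 1, Y 2 2; 0, 0, -Y 1 0; 0, 0, 0], ?_⟩
  rw [single_two_zero_bracket_eq]
  ext i j
  fin_cases i <;> fin_cases j <;> simp [h01, h02, h11, h12]
  linear_combination -htr

/-- `ad_K N⁻` applied: `(mulLeft N⁻ − mulRight N⁻) A = N⁻ A − A N⁻`. [folklore] -/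
theorem adK_apply (A : Matrix (Fin 3) (Fin 3) K) :
    ((LinearMap.mulLeft K (Matrix.single (2 : Fin 3) (0 : Fin 3) (1 : K)) - LinearMap.mulRight K (Matrix.single (2 : Fin 3) (0 : Fin 3) (1 : K))) :
        Module.End K (Matrix (Fin 3) (Fin 3) K)) A =
      Matrix.single (2 : Fin 3) (0 : Fin 3) (1 : K) * A - A * Matrix.single (2 : Fin 3) (0 : Fin 3) 1 := by
  simp [LinearMap.sub_apply, LinearMap.mulLeft_apply, LinearMap.mulRight_apply]


/-- `trace (c(Y)(N + Z)c(Y)⁻¹ − N) = 0` when `trace N = trace Z = 0` (total version with `Ring.inverse`: in the junk cases the conjugate is `0`). [cite: HarishChandra1970, Part V §4 Lemma 22] -/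
theorem trace_slice_sub_eq_zero {N Y Z : Matrix (Fin 3) (Fin 3) K} (hN : Matrix.trace N = 0) (hZ : Matrix.trace Z = 0) :
    Matrix.trace (cayley Y * (N + Z) * Ring.inverse (cayley Y) - N) = 0 := by
  rw [Matrix.trace_sub, hN, sub_zero]
  by_cases hp : IsUnit (1 + Y)
  · by_cases hm : IsUnit (1 - Y)
    · obtain ⟨u, hu⟩ := isUnit_cayley hp hm
      rw [← hu, Ring.inverse_unit, Matrix.trace_units_conj, Matrix.trace_add, hN, hZ, add_zero]
    · have h0 : Ring.inverse (cayley Y) = 0 := Ring.inverse_non_unit _ (fun h => hm ((isUnit_cayley_iff hp).1 h))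
      rw [h0, Matrix.mul_zero, Matrix.trace_zero]
  · have h0 : cayley Y = 0 := by rw [cayley_def, Ring.inverse_non_unit _ hp, mul_zero]
    rw [h0, Matrix.zero_mul, Matrix.zero_mul, Matrix.trace_zero]

end Algebra


end Summit.HodgeConjecture.HodgeConjecture.Cruxes.H413.F0P3cStCharTSHCDSlodowySliceChartAlgebra

end
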